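import Literature.Analysis.FunctionSpaces.TorusSobolevNorm
import Literature.Analysis.FunctionSpaces.TorusFourierSynthesis
import HarnessLib

/-!
# Smooth functions lie in every `H^s(T^d)`: discharge of `Torus.IsSmooth.memSobolev`

Discharge of the named fact `Literature.Analysis.FunctionSpaces.Torus.IsSmooth.memSobolev` of
`Literature.Analysis.FunctionSpaces.TorusSobolevNorm`:

* `Torus.IsSmooth.memSobolev_holds` — for every smooth `f : T^d → F` (complex normed target `F`)
  and every real `s`, `f ∈ H^s(T^d; F)`, i.e. `f` is integrable and
  `‖f‖²_{H^s} = ∑_k ⟨k⟩^{2s} ‖f̂(k)‖² < ∞`.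

This is the standard consequence of the decay of the Fourier coefficients of smooth functions,
Grafakos 2014, Thm. 3.3.9 (a) (book p. 196): for `s ∈ ℤ`, `s ≥ 0` and `∂^α f` integrable for
`|α| ≤ s`, `|f̂(m)| ≤ (√n / 2π)^s max_{|α| = s} |(∂^α f)^(m)| / |m|^s` (`m ≠ 0`), proved by
integrating by parts `s` times in the variable `x_j` with `|m_j|` maximal (eq. (3.3.9); the
boundary terms vanish by periodicity), and its Cor. 3.3.10 (a) (book p. 197):
`|f̂(m)| ≤ c_{n,s} max(‖f‖_{L¹}, max_{|α| = s} ‖∂^α f‖_{L¹}) (1 + |m|)^{-s}`.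

In the tree the decay theorem is `Torus.IsSmooth.rapidDecay_mFourierCoeff`
(`TorusFourierSynthesis`, complete targets): `∑_k (1 + |k|²)^m ‖f̂(k)‖ < ∞` for every `m ∈ ℕ`
(there the integration by parts is packaged as `𝓕((1 - Δ/4π²)^m f)(k) = (1 + |k|²)^m f̂(k)` and
`‖ĝ(k)‖ ≤ sup ‖g‖`). The proof below:

1. `Torus.sobolevWeight_natCast_sq` — `⟨k⟩^{2n} = (1 + |k|²)^n` for `n ∈ ℕ`;
2. `Torus.IsSmooth.tsum_sobolevWeight_sq_mul_enorm_sq_lt_top` — for a complete target,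
   `∑_k (1 + |k|²)^n ‖f̂(k)‖² ≤ (sup ‖f‖) · ∑_k (1 + |k|²)^n ‖f̂(k)‖ < ∞`, using
   `‖f̂(k)‖ ≤ sup ‖f‖` (`Torus.norm_mFourierCoeff_le_of_forall_norm_le`, `|T^d| = 1`);
3. `Torus.IsSmooth.memSobolev_holds` — integrability of smooth functions
   (`Torus.IsSmooth.integrable`), monotonicity of the scale (`Torus.eSobolevNorm_mono`, reduce
   `s` to a natural number `n ≥ s`) and step 2; for a non-complete target every Bochner
   integral, hence every Fourier coefficient, is `0` (`MeasureTheory.integral_of_not_completeSpace`),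
   so the norm is `0`.

## References

* L. Grafakos, *Classical Fourier Analysis*, 3rd ed., GTM 249 (Springer 2014), Thm. 3.3.9 (a)
  and Cor. 3.3.10 (a) (book pp. 196–197; PDF pp. 204–205), §3.3.1. [Grafakos2014]
-/

open MeasureTheory Set Filter Topology UnitAddTorus
open scoped ENNReal NNReal

noncomputable section

namespace Literature.Analysis.FunctionSpaces

namespace Torus

variable {d : Type*} [Fintype d]
variable {F : Type*} [NormedAddCommGroup F] [NormedSpace ℂ F]

/-- The squared weight of natural order is a natural power: `(⟨k⟩^n)² = (1 + |k|²)^n`.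
[folklore] -/
theorem sobolevWeight_natCast_sq (n : ℕ) (k : d → ℤ) :
    sobolevWeight (n : ℝ) k ^ 2 = (1 + freqNormSq k) ^ n := by
  have h : (0 : ℝ) ≤ 1 + freqNormSq k := by linarith [freqNormSq_nonneg k]
  rw [sobolevWeight, ← Real.rpow_natCast, ← Real.rpow_mul h,
    show (n : ℝ) / 2 * ((2 : ℕ) : ℝ) = (n : ℝ) by push_cast; ring, Real.rpow_natCast]

/-- **The `H^n` sum of a smooth function is finite** (complete target): for smooth
`f : T^d → F` and `n ∈ ℕ`, `∑_k ⟨k⟩^{2n} ‖f̂(k)‖² < ∞`. Proof: the coefficients of a smooth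
function decay rapidly, `∑_k (1 + |k|²)^n ‖f̂(k)‖ < ∞` (`Torus.IsSmooth.rapidDecay_mFourierCoeff`,
Grafakos 2014, Thm. 3.3.9 (a)), and `‖f̂(k)‖ ≤ sup ‖f‖`, so
`(1 + |k|²)^n ‖f̂(k)‖² ≤ (sup ‖f‖) (1 + |k|²)^n ‖f̂(k)‖`. [cite: Grafakos2014, Thm. 3.3.9 (a)] -/
theorem IsSmooth.tsum_sobolevWeight_sq_mul_enorm_sq_lt_top [CompleteSpace F]
    {f : UnitAddTorus d → F} (hf : IsSmooth f) (n : ℕ) :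
    ∑' k, ENNReal.ofReal (sobolevWeight (n : ℝ) k ^ 2) * ‖mFourierCoeff f k‖ₑ ^ 2 < ∞ := by
  classical
  -- rapid decay of the coefficients (Grafakos 2014, Thm. 3.3.9 (a))
  have hR : Summable fun k => (1 + freqNormSq k) ^ n * ‖mFourierCoeff f k‖ :=
    hf.rapidDecay_mFourierCoeff n
  -- a uniform bound on the coefficients: `‖f̂(k)‖ ≤ K := sup ‖f‖`
  obtain ⟨K, hK⟩ := isCompact_univ.exists_bound_of_continuousOn hf.continuous.continuousOn
  have hK' : ∀ k, ‖mFourierCoeff f k‖ ≤ K := fun k =>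
    norm_mFourierCoeff_le_of_forall_norm_le (fun x => hK x (mem_univ x)) k
  have hle : ∀ k, ENNReal.ofReal (sobolevWeight (n : ℝ) k ^ 2) * ‖mFourierCoeff f k‖ₑ ^ 2 ≤
      ENNReal.ofReal ((1 + freqNormSq k) ^ n * ‖mFourierCoeff f k‖) * ENNReal.ofReal K := by
    intro k
    rw [sobolevWeight_natCast_sq, ← ofReal_norm, sq, ← mul_assoc,
      ← ENNReal.ofReal_mul (one_add_freqNormSq_pow_nonneg k n)]
    gcongr
    exact hK' k
  refine lt_of_le_of_lt (ENNReal.tsum_le_tsum hle) ?_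
  rw [ENNReal.tsum_mul_right, ← ENNReal.ofReal_tsum_of_nonneg
    (fun k => mul_nonneg (one_add_freqNormSq_pow_nonneg k n) (norm_nonneg _)) hR]
  exact ENNReal.mul_lt_top ENNReal.ofReal_lt_top ENNReal.ofReal_lt_top

/-- Discharge of the named fact `Torus.IsSmooth.memSobolev`: **smooth functions lie in every
`H^s(T^d)`** — for smooth `f : T^d → F` and every `s ∈ ℝ`, `f` is integrable and
`‖f‖_{H^s} < ∞`, because `f̂(k)` decays faster than any power of `|k|` (Grafakos 2014,
Thm. 3.3.9 (a) / Cor. 3.3.10 (a): `|f̂(m)| ≤ c_{n,s} max(‖f‖₁, ‖∂^α f‖₁)(1 + |m|)^{-s}` for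
`f ∈ C^s(𝐓ⁿ)`, every `s`). Proof: reduce to a natural order `n ≥ s` by monotonicity of the scale
and use `Torus.IsSmooth.tsum_sobolevWeight_sq_mul_enorm_sq_lt_top`; for a non-complete target all
Fourier coefficients are the junk value `0` of the Bochner integral and the norm vanishes.
[cite: Grafakos2014, Thm. 3.3.9 (a) and Cor. 3.3.10 (a)] -/
theorem IsSmooth.memSobolev_holds : IsSmooth.memSobolev (d := d) (F := F) := by
  intro f hf s
  refine ⟨hf.integrable, ?_⟩
  -- reduce to a natural order `n ≥ s`
  obtain ⟨n, hn⟩ : ∃ n : ℕ, s ≤ n := exists_nat_ge s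
  refine (eSobolevNorm_mono hn f).trans_lt ?_
  by_cases hF : CompleteSpace F
  · exact ENNReal.rpow_lt_top_of_nonneg (by norm_num)
      (hf.tsum_sobolevWeight_sq_mul_enorm_sq_lt_top n).ne
  · -- every Bochner integral with values in a non-complete space is `0`
    have h0 : ∀ k : d → ℤ, mFourierCoeff f k = 0 := fun k => by
      simp [mFourierCoeff, integral_of_not_completeSpace hF]
    simp [eSobolevNorm, h0]

end Torus

end Literature.Analysis.FunctionSpaces
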